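import Summits.NavierStokesRegularity.NavierStokesRegularity.Theses.ScaledTopAlignment
import Summits.NavierStokesRegularity.NavierStokesRegularity.Theorems.ScaledTopAlignmentNearMaxMostTimesGlueKit
import Summits.NavierStokesRegularity.NavierStokesRegularity.Theorems.ScaledTopAlignmentMostTimesHardCoreMeet
import Summits.NavierStokesRegularity.NavierStokesRegularity.Theorems.ScaledTopAlignmentNearMaxMostTimesRung
import HarnessLib

/-!
# Line `nearmax` on crux `AprioriMostTimesBulkAlignment` (stmt-NavierStokesRegularity-19551, W3ᵐᵗ) — the NEAR-MAXIMUM MOST-TIMES door W3ⁿᵐ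
# registered as a SECOND LINE (DIRECTOR-NS #13 (1), 2026-08-26T21:06Z), not as a `closes` re-bind

Pre-registered origin: nsreg-p3 RESULT-6 FINAL (dircoh-4/RESULT-6.md §8, decision matrix ROUND-7 §3 add.2 as amended in ROUND-8 Add. 1):
«S-6 FIRES ∧ S-7 HOLDS ⇒ EXECUTE the banked near-max set rev16/».  The director OBJECTED to executing it as a route edit (door change
W3ᵐᵗ → W3ⁿᵐ re-binding `closes`): by the door calculus (`door_iff_target_of_kill_of_regular`, `aprioriMostTimesBulkAlignment_iff_target_and_typeII`)
W3ⁿᵐ ≡ W3ᵐᵗ ≡ Target (stmt-1217) modulo NoTypeII, so a re-bind moves advertised premise structure, not distance, and it would orphan the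
registered line of record `Lines/recurrent.lean`.  PERMITTED INSTEAD, and done here: the same content as a LINE — two stubs and a sorry-free
composition concluding the crux BY NAME.

* STUB 1 `stub_nearMaxMostTimes` = W3ⁿᵐ `AprioriNearMaxMostTimesBulkAlignment` VERBATIM (rev16/W3nm.signature.txt = the hypothesis `hW` of the landed
  kit theorem `navierStokesRegularity_of_nearMaxMostTimesBulkAlignment_of_noTypeII`, p437921): W3ᵐᵗ's window clause demanded only at points that are
  ALSO relative near-maxima `∀ x', q·|ω(t,x')| ≤ |ω(t,x)|`, for every `q > 0`.
* STUB 2 `stub_typeIIResidue` = the Type-II residue R_II, the SAME statement as `Lines/recurrent.lean`'s STUB 2 (shared stub; vacuous under the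
  route's residual NoTypeII — side certificate `Recurrent.stub_typeIIResidue_of_noTypeII` there).
* COMPOSITION `aprioriMostTimesBulkAlignment_holds_of_stubs` (no sorry outside the stubs): STUB 1 kills Type I at every solution of the class through
  `false_of_nearMaxMostTimesBulkAligned_typeI` (flexible zoom + Fatou window + `eq_zero_of_aligned_window`), giving `ThreadingFlux.Target`; then
  `aprioriMostTimesBulkAlignment_iff_target_and_typeII.mpr ⟨Target, STUB 2⟩` is the crux.

HONEST LABEL (costume caveat, stated so the skeleton's readers need not discover it): STUB 1 ⟸ the crux by the landed one-line rung
`nearMaxMostTimesBulkAlignment_of_aprioriMostTimesBulkAlignment` (side certificate below), and STUB 1 ∧ STUB 2 ⟹ the crux (this file); so modulo the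
residual the line RE-ADVERTISES the crux in its near-max form — it does not split it.  Its use: near-max-specific partial results (relative-top
coherence stubs, the SPLIT-9 items UDW/PL₁ᵀ of nsreg-p3 ROUND-8 Add. 3 once funded and typed as tree statements) can be filed `--supports
stmt-NavierStokesRegularity-19551` against a REGISTERED parent whose open stub is exactly the near-max door.  Distance to the summit is unchanged.
WHAT THIS IS NOT: not NS regularity; no new theorem content beyond composition of landed results.
-/

namespace Summit.NavierStokesRegularity.NavierStokesRegularity.Cruxes.AprioriMostTimesBulkAlignment.Nearmax

open MeasureTheory Set Literature.Analysis.FluidPDE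
open Summit.NavierStokesRegularity.NavierStokesRegularity.Theorems

/-- STUB 1 (the open one): the near-maximum most-times window-bulk door W3ⁿᵐ `AprioriNearMaxMostTimesBulkAlignment` (rev16/W3nm.signature.txt,
verbatim the hypothesis of `navierStokesRegularity_of_nearMaxMostTimesBulkAlignment_of_noTypeII`). -/
theorem stub_nearMaxMostTimes :
    ∀ (ν T : ℝ), 0 < ν → 0 < T → ∀ (u : ℝ → EuclideanSpace ℝ (Fin 3) → EuclideanSpace ℝ (Fin 3))
      (p : ℝ → EuclideanSpace ℝ (Fin 3) → ℝ), IsClassicalNSSolutionOn (Set.Ico 0 T) ν 0 u p →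
      IsLerayHopfOn T ν 0 (u 0) u → HasRapidSpatialDecay (u 0) →
      ∃ lam0 : ℝ, lam0 < 1 ∧ ∃ R0 : ℝ, 0 < R0 ∧ ∃ θ : ℝ, θ < 1 ∧ ∀ κ : ℝ, 0 < κ → ∀ q : ℝ, 0 < q →
        ∀ ε : ℝ, 0 < ε → ∀ δ : ℝ, 0 < δ → ∃ M : ℝ, 0 < M ∧ ∃ E : Set ℝ,
        (∃ h0 : ℝ, 0 < h0 ∧ ∀ h : ℝ, 0 < h → h < h0 →
          MeasureTheory.volume (E ∩ Set.Ioo (T - h) T) ≤ ENNReal.ofReal (θ * h)) ∧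
        ∀ t ∈ Set.Ico 0 T, t ∉ E → ∀ x : EuclideanSpace ℝ (Fin 3), M ≤ ‖curl (u t) x‖ →
        κ / (T - t) ≤ ‖curl (u t) x‖ → (∀ x' : EuclideanSpace ℝ (Fin 3), q * ‖curl (u t) x'‖ ≤ ‖curl (u t) x‖) →
          MeasureTheory.volume {y : EuclideanSpace ℝ (Fin 3) | lam0 * ‖curl (u t) x‖ ≤ ‖curl (u t) y‖ ∧
              ‖x - y‖ ≤ R0 * Real.sqrt (ν / ‖curl (u t) x‖) ∧
              ε < Real.sqrt (1 - (inner ℝ (‖curl (u t) x‖⁻¹ • curl (u t) x)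
                (‖curl (u t) y‖⁻¹ • curl (u t) y)) ^ 2)}
            ≤ ENNReal.ofReal (δ * Real.sqrt (ν / ‖curl (u t) x‖) ^ 3) := by
  sorry

/-- STUB 2 (shared with `Lines/recurrent.lean`): the Type-II residue R_II of the door (verbatim the second conjunct of
`aprioriMostTimesBulkAlignment_iff_target_and_typeII`); vacuous under the route's residual NoTypeII. -/
theorem stub_typeIIResidue :
    ∀ (ν T : ℝ), 0 < ν → 0 < T → ∀ (u : ℝ → EuclideanSpace ℝ (Fin 3) → EuclideanSpace ℝ (Fin 3))
        (p : ℝ → EuclideanSpace ℝ (Fin 3) → ℝ),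
        IsClassicalNSSolutionOn (Set.Ico 0 T) ν 0 u p → IsLerayHopfOn T ν 0 (u 0) u →
        HasRapidSpatialDecay (u 0) → ¬ HasSmoothExtensionPast ν 0 u T → ¬ IsTypeIBlowup u T →
        ∃ lam0 : ℝ, lam0 < 1 ∧ ∃ R0 : ℝ, 0 < R0 ∧ ∃ θ : ℝ, θ < 1 ∧ ∀ κ : ℝ, 0 < κ → ∀ ε : ℝ, 0 < ε →
          ∀ δ : ℝ, 0 < δ → ∃ M : ℝ, 0 < M ∧ ∃ E : Set ℝ,
            (∃ h0 : ℝ, 0 < h0 ∧ ∀ h : ℝ, 0 < h → h < h0 →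
              volume (E ∩ Set.Ioo (T - h) T) ≤ ENNReal.ofReal (θ * h)) ∧
            ∀ t ∈ Set.Ico 0 T, t ∉ E → ∀ x : EuclideanSpace ℝ (Fin 3), M ≤ ‖curl (u t) x‖ →
              κ / (T - t) ≤ ‖curl (u t) x‖ →
              volume {y : EuclideanSpace ℝ (Fin 3) | lam0 * ‖curl (u t) x‖ ≤ ‖curl (u t) y‖ ∧
                  ‖x - y‖ ≤ R0 * Real.sqrt (ν / ‖curl (u t) x‖) ∧
                  ε < Real.sqrt (1 - (inner ℝ (‖curl (u t) x‖⁻¹ • curl (u t) x)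
                    (‖curl (u t) y‖⁻¹ • curl (u t) y)) ^ 2)}
                ≤ ENNReal.ofReal (δ * Real.sqrt (ν / ‖curl (u t) x‖) ^ 3) := by
  sorry

/-- SKELETON / COMPOSITION (sorry-free given the stubs; concludes the crux BY NAME): STUB 1 gives `ThreadingFlux.Target`
(no Type-I first blow-up in the class) through `false_of_nearMaxMostTimesBulkAligned_typeI` and the slab bound; with STUB 2 the
landed equivalence `aprioriMostTimesBulkAlignment_iff_target_and_typeII` returns W3ᵐᵗ. -/
theorem aprioriMostTimesBulkAlignment_holds_of_stubs :
    Summit.NavierStokesRegularity.NavierStokesRegularity.Theses.ScaledTopAlignment.AprioriMostTimesBulkAlignment := by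
  refine aprioriMostTimesBulkAlignment_iff_target_and_typeII.mpr ⟨?_, stub_typeIIResidue⟩
  intro ν T hν hT u p hcl hLH hdec hI
  by_contra hext
  obtain ⟨lam0, hlam01, R0, hR0, θ, hθ, hfam⟩ := stub_nearMaxMostTimes ν T hν hT u p hcl hLH hdec
  exact false_of_nearMaxMostTimesBulkAligned_typeI hν hT hcl hLH hdec
    (slabBound_of_classical_lerayHopf hν hT hcl hLH hdec) hI hext hlam01 hR0 hθ hfam

/-- Side certificate (sorry-free; the costume caveat made checkable): the crux implies STUB 1 by the landed rung — so, modulo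
STUB 2, this line re-advertises W3ᵐᵗ in near-max form rather than splitting it. -/
theorem stub_nearMaxMostTimes_of_crux
    (hW : Summit.NavierStokesRegularity.NavierStokesRegularity.Theses.ScaledTopAlignment.AprioriMostTimesBulkAlignment) :
    ∀ (ν T : ℝ), 0 < ν → 0 < T → ∀ (u : ℝ → EuclideanSpace ℝ (Fin 3) → EuclideanSpace ℝ (Fin 3))
      (p : ℝ → EuclideanSpace ℝ (Fin 3) → ℝ), IsClassicalNSSolutionOn (Set.Ico 0 T) ν 0 u p →
      IsLerayHopfOn T ν 0 (u 0) u → HasRapidSpatialDecay (u 0) →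
      ∃ lam0 : ℝ, lam0 < 1 ∧ ∃ R0 : ℝ, 0 < R0 ∧ ∃ θ : ℝ, θ < 1 ∧ ∀ κ : ℝ, 0 < κ → ∀ q : ℝ, 0 < q →
        ∀ ε : ℝ, 0 < ε → ∀ δ : ℝ, 0 < δ → ∃ M : ℝ, 0 < M ∧ ∃ E : Set ℝ,
        (∃ h0 : ℝ, 0 < h0 ∧ ∀ h : ℝ, 0 < h → h < h0 →
          MeasureTheory.volume (E ∩ Set.Ioo (T - h) T) ≤ ENNReal.ofReal (θ * h)) ∧
        ∀ t ∈ Set.Ico 0 T, t ∉ E → ∀ x : EuclideanSpace ℝ (Fin 3), M ≤ ‖curl (u t) x‖ →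
        κ / (T - t) ≤ ‖curl (u t) x‖ → (∀ x' : EuclideanSpace ℝ (Fin 3), q * ‖curl (u t) x'‖ ≤ ‖curl (u t) x‖) →
          MeasureTheory.volume {y : EuclideanSpace ℝ (Fin 3) | lam0 * ‖curl (u t) x‖ ≤ ‖curl (u t) y‖ ∧
              ‖x - y‖ ≤ R0 * Real.sqrt (ν / ‖curl (u t) x‖) ∧
              ε < Real.sqrt (1 - (inner ℝ (‖curl (u t) x‖⁻¹ • curl (u t) x)
                (‖curl (u t) y‖⁻¹ • curl (u t) y)) ^ 2)}
            ≤ ENNReal.ofReal (δ * Real.sqrt (ν / ‖curl (u t) x‖) ^ 3) :=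
  nearMaxMostTimesBulkAlignment_of_aprioriMostTimesBulkAlignment hW

/-- Side certificate (sorry-free): with the route's residual NoTypeII (stmt-0056), STUB 1 alone gives Clay (A) — the landed kit
theorem, restated so the line's open content given the residual is visibly STUB 1. -/
theorem navierStokesRegularity_of_stub1_of_noTypeII
    (hII : Summit.NavierStokesRegularity.NavierStokesRegularity.Theses.ScaledTopAlignment.NoTypeII) :
    NavierStokesRegularity :=
  navierStokesRegularity_of_nearMaxMostTimesBulkAlignment_of_noTypeII stub_nearMaxMostTimes hII

end Summit.NavierStokesRegularity.NavierStokesRegularity.Cruxes.AprioriMostTimesBulkAlignment.Nearmax
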